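import Summits.SmoothPoincare4.SmoothPoincare4.Theorems.CongruenceShadowsGriffithsHandlebodyExtensionCoverProfile
import HarnessLib

/-!
# SmoothPoincare4 / CongruenceShadows — `GriffithsHandlebodyExtension` (item stmt-SmoothPoincare4-15190): the homothety-cover core, III — the cone chart and the leaf chart

Support file (`--supports` stmt-SmoothPoincare4-15190) of the homothety-cover proof of the genus-one
clause (E) of Griffiths' handlebody extension theorem — *every self-diffeomorphism of the Heegaard torus
`∂V` of the round solid torus fixing the base point and acting trivially on `π₁(∂V)` extends to a
self-diffeomorphism of `V`* (hypothesis `hE` of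
`Literature.Topology.FourManifolds.RoundSolidTorusModel.diffeoExtends_of_map_ker_eq_ker_of_forall_diffeoExtends`).
See the module docstring of `…CoverDefs` for the whole line (E1–E6) and the notation
(`τ̂`, `δ_λ`, `ρ`, `χ`, `f`, `Δ^(c)`, `α`, `L`, `M`, `Ψ̂`, `ẽ_c`).

This part: the cone chart `α (c, u) = c · σ(u)` over the inverse stereographic projection `σ` and its inverse
`α⁻¹` (formulas, smoothness, behaviour under the homothety), and the leaf chart `L (c, Y) = (Y, f c Y)`:
injective on `U = {c > 0}` with smooth local inverse (inverse function theorem, `∂f/∂c ≥ 1`).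
-/

-- the registered namespace `Summit.SmoothPoincare4.SmoothPoincare4.Theorems` repeats a component
set_option linter.dupNamespace false

noncomputable section

namespace Summit.SmoothPoincare4.SmoothPoincare4.Theorems

namespace HomothetyCover

open Set Function Metric Filter
open scoped Topology ContDiff

/-- `rad ≥ 0`. -/
theorem rad_nonneg (p : E2 × ℝ) : 0 ≤ rad p := Real.sqrt_nonneg _

/-- `rad (Y, t)² = ‖Y‖² + t²`. -/
theorem rad_sq_eq (p : E2 × ℝ) : rad p ^ 2 = ‖p.1‖ ^ 2 + p.2 ^ 2 :=
  Real.sq_sqrt (by positivity)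

/-- `|t| ≤ rad (Y, t)`. -/
theorem abs_snd_le_rad (p : E2 × ℝ) : |p.2| ≤ rad p :=
  Real.abs_le_sqrt (by nlinarith [sq_nonneg ‖p.1‖])

/-- `‖Y‖ ≤ rad (Y, t)`. -/
theorem norm_fst_le_rad (p : E2 × ℝ) : ‖p.1‖ ≤ rad p := by
  have h := Real.abs_le_sqrt (x := ‖p.1‖) (y := ‖p.1‖ ^ 2 + p.2 ^ 2) (by nlinarith [sq_nonneg p.2])
  rwa [abs_of_nonneg (norm_nonneg _)] at h

/-- `rad p = 0 ↔ p = 0`. -/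
theorem rad_eq_zero_iff (p : E2 × ℝ) : rad p = 0 ↔ p = 0 := by
  constructor
  · intro h
    have h2 := rad_sq_eq p
    rw [h] at h2
    have h3 : ‖p.1‖ ^ 2 = 0 := by nlinarith [sq_nonneg ‖p.1‖, sq_nonneg p.2]
    have h4 : p.2 ^ 2 = 0 := by nlinarith [sq_nonneg ‖p.1‖, sq_nonneg p.2]
    have h5 : p.1 = 0 := by simpa using h3
    have h6 : p.2 = 0 := by simpa using h4
    exact Prod.ext h5 h6
  · rintro rfl; simp [rad]

/-- `rad > 0` off the origin. -/
theorem rad_pos {p : E2 × ℝ} (hp : p ≠ 0) : 0 < rad p :=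
  lt_of_le_of_ne (rad_nonneg p) (fun h => hp ((rad_eq_zero_iff p).1 h.symm))

/-- `rad (Y, t) + t > 0` on the punctured closed upper half-space. -/
theorem rad_add_snd_pos {p : E2 × ℝ} (hp : p ∈ Hpunct) : 0 < rad p + p.2 := by
  have := rad_pos hp.2; have := hp.1; linarith

/-- The punctured closed upper half-space is invariant under positive homotheties. -/
theorem smul_mem_Hpunct {l : ℝ} (hl : 0 < l) {p : E2 × ℝ} (hp : p ∈ Hpunct) : l • p ∈ Hpunct := by
  refine ⟨?_, ?_⟩
  · show 0 ≤ l • p.2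
    rw [smul_eq_mul]; exact mul_nonneg hl.le hp.1
  · intro h
    exact hp.2 ((smul_eq_zero.1 h).resolve_left hl.ne')

/-- `‖α (c, u)‖ = c`. -/
theorem rad_α {c : ℝ} (hc : 0 < c) (u : E2) : rad (α (c, u)) = c := by
  have hs : (0 : ℝ) < 1 + ‖u‖ ^ 2 := by positivity
  have key : ‖(2 * c / (1 + ‖u‖ ^ 2)) • u‖ ^ 2 + (c * (1 - ‖u‖ ^ 2) / (1 + ‖u‖ ^ 2)) ^ 2 = c ^ 2 := by
    rw [norm_smul, mul_pow, Real.norm_eq_abs, sq_abs]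
    field_simp
    ring
  rw [rad, α, key, Real.sqrt_sq hc.le]

/-- `α⁻¹ ∘ α = id` on `{c > 0}`. -/
theorem αinv_α {c : ℝ} (hc : 0 < c) (u : E2) : αinv (α (c, u)) = (c, u) := by
  have hs : (0 : ℝ) < 1 + ‖u‖ ^ 2 := by positivity
  refine Prod.ext (rad_α hc u) ?_
  simp only [αinv, rad_α hc u]
  simp only [α]
  rw [smul_smul]
  have : (c + c * (1 - ‖u‖ ^ 2) / (1 + ‖u‖ ^ 2))⁻¹ * (2 * c / (1 + ‖u‖ ^ 2)) = 1 := by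
    field_simp
    ring
  rw [this, one_smul]

/-- `‖(α⁻¹ p).2‖² = (r - t)/(r + t)`: the squared norm of the stereographic coordinate. -/
theorem norm_sq_αinv_snd (p : E2 × ℝ) (h : 0 < rad p + p.2) :
    ‖(αinv p).2‖ ^ 2 = (rad p - p.2) / (rad p + p.2) := by
  have hr2 := rad_sq_eq p
  simp only [αinv]
  rw [norm_smul, mul_pow, Real.norm_eq_abs, sq_abs, inv_pow]
  field_simp
  nlinarith [hr2]

/-- `α ∘ α⁻¹ = id` off the closed lower axis. -/
theorem α_αinv {p : E2 × ℝ} (h : 0 < rad p + p.2) : α (αinv p) = p := by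
  have hr2 := rad_sq_eq p
  have hs := norm_sq_αinv_snd p h
  have hr : 0 < rad p := by
    rcases lt_or_ge 0 (rad p) with h' | h'
    · exact h'
    · have h0 : rad p = 0 := le_antisymm h' (rad_nonneg p)
      have := (rad_eq_zero_iff p).1 h0
      subst this
      simp [h0] at h
  obtain ⟨Y, t⟩ := p
  simp only at hr2 hs h hr ⊢
  set r := rad (Y, t) with hrdef
  have hr0 : r ≠ 0 := hr.ne'
  have hσ0 : r + t ≠ 0 := h.ne'
  have h2r : 1 + (r - t) / (r + t) = 2 * r / (r + t) := by
    field_simp; ring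
  have h1m : 1 - (r - t) / (r + t) = 2 * t / (r + t) := by
    field_simp; ring
  have e1 : (2 * r / (1 + ‖(αinv (Y, t)).2‖ ^ 2)) * (r + t)⁻¹ = 1 := by
    rw [hs, h2r]
    field_simp
  have e2 : r * (1 - ‖(αinv (Y, t)).2‖ ^ 2) / (1 + ‖(αinv (Y, t)).2‖ ^ 2) = t := by
    rw [hs, h2r, h1m]
    field_simp
  have hsnd : (αinv (Y, t)).2 = (r + t)⁻¹ • Y := rfl
  refine Prod.ext ?_ ?_
  · show (2 * (αinv (Y, t)).1 / (1 + ‖(αinv (Y, t)).2‖ ^ 2)) • (αinv (Y, t)).2 = Y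
    have hfst : (αinv (Y, t)).1 = r := rfl
    rw [hfst, hsnd, smul_smul]
    rw [hsnd] at e1
    rw [e1, one_smul]
  · show (αinv (Y, t)).1 * (1 - ‖(αinv (Y, t)).2‖ ^ 2) / (1 + ‖(αinv (Y, t)).2‖ ^ 2) = t
    exact e2

/-- Points of the closed upper half-space have stereographic coordinate in the closed unit disc. -/
theorem norm_αinv_snd_le_one {p : E2 × ℝ} (hp : p ∈ Hpunct) : ‖(αinv p).2‖ ≤ 1 := by
  have h := rad_add_snd_pos hp
  have hs := norm_sq_αinv_snd p h
  have h1 : ‖(αinv p).2‖ ^ 2 ≤ 1 := by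
    rw [hs, div_le_one h]; linarith [hp.1]
  nlinarith [norm_nonneg ((αinv p).2), h1]

/-- Points of the boundary plane have stereographic coordinate on the unit circle. -/
theorem norm_αinv_snd_eq_one {y : E2} (hy : y ≠ 0) : ‖(αinv (y, 0)).2‖ = 1 := by
  have hr : rad (y, 0) = ‖y‖ := by simp [rad, Real.sqrt_sq (norm_nonneg _)]
  simp only [αinv, hr, add_zero]
  rw [norm_smul, norm_inv, norm_norm, inv_mul_cancel₀ (norm_ne_zero_iff.2 hy)]

/-- `α` maps `(0, ∞) × D̄` into the punctured closed upper half-space. -/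
theorem α_mem_Hpunct {c : ℝ} (hc : 0 < c) {u : E2} (hu : ‖u‖ ≤ 1) : α (c, u) ∈ Hpunct := by
  constructor
  · show 0 ≤ c * (1 - ‖u‖ ^ 2) / (1 + ‖u‖ ^ 2)
    apply div_nonneg _ (by positivity : (0 : ℝ) < 1 + ‖u‖ ^ 2).le
    apply mul_nonneg hc.le
    nlinarith [norm_nonneg u]
  · intro h
    have := rad_α hc u
    rw [h, (rad_eq_zero_iff 0).2 rfl] at this
    exact hc.ne this

/-- `α` is smooth. -/
theorem contDiff_α : ContDiff ℝ ∞ α := by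
  have h1 : ContDiff ℝ ∞ fun q : ℝ × E2 => 1 + ‖q.2‖ ^ 2 :=
    contDiff_const.add ((contDiff_norm_sq ℝ).comp contDiff_snd)
  have h0 : ∀ q : ℝ × E2, 1 + ‖q.2‖ ^ 2 ≠ 0 := fun q => (by positivity : (0 : ℝ) < 1 + ‖q.2‖ ^ 2).ne'
  refine ContDiff.prodMk ?_ ?_
  · exact ((contDiff_const.mul contDiff_fst).div h1 h0).smul contDiff_snd
  · exact (contDiff_fst.mul (contDiff_const.sub ((contDiff_norm_sq ℝ).comp contDiff_snd))).div h1 h0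

/-- `rad` is smooth off the origin. -/
theorem contDiffAt_rad {p : E2 × ℝ} (hp : p ≠ 0) : ContDiffAt ℝ ∞ rad p := by
  have h1 : ContDiffAt ℝ ∞ (fun p : E2 × ℝ => ‖p.1‖ ^ 2 + p.2 ^ 2) p :=
    (((contDiff_norm_sq ℝ).comp contDiff_fst).add (contDiff_snd.pow 2)).contDiffAt
  refine h1.sqrt ?_
  have := rad_pos hp
  have h2 := rad_sq_eq p
  nlinarith

/-- `α⁻¹` is smooth off the closed lower axis. -/
theorem contDiffAt_αinv {p : E2 × ℝ} (hp : p ≠ 0) (h : 0 < rad p + p.2) :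
    ContDiffAt ℝ ∞ αinv p :=
  (contDiffAt_rad hp).prodMk (((contDiffAt_rad hp).add contDiffAt_snd).inv h.ne' |>.smul contDiffAt_fst)

/-- `rad` is homogeneous of degree one. -/
theorem rad_smul {l : ℝ} (hl : 0 < l) (p : E2 × ℝ) : rad (l • p) = l * rad p := by
  simp only [rad, Prod.smul_fst, Prod.smul_snd, smul_eq_mul, norm_smul, Real.norm_eq_abs,
    abs_of_pos hl]
  rw [show (l * ‖p.1‖) ^ 2 + (l * p.2) ^ 2 = l ^ 2 * (‖p.1‖ ^ 2 + p.2 ^ 2) by ring,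
    Real.sqrt_mul (sq_nonneg l), Real.sqrt_sq hl.le]

/-- In the chart `α` the homothety `p ↦ l • p` is `(c, u) ↦ (l c, u)`. -/
theorem αinv_smul {l : ℝ} (hl : 0 < l) {p : E2 × ℝ} (h : 0 < rad p + p.2) :
    αinv (l • p) = (l * rad p, (αinv p).2) := by
  refine Prod.ext (rad_smul hl p) ?_
  simp only [αinv, rad_smul hl, Prod.smul_fst, Prod.smul_snd, smul_eq_mul]
  rw [show l * rad p + l * p.2 = l * (rad p + p.2) by ring, mul_inv, smul_smul]
  congr 1
  field_simp

/-- `α (l c, u) = l • α (c, u)`: the cone chart intertwines scaling of the leaf parameter with the homothety. -/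
theorem α_mul_left (l c : ℝ) (u : E2) : α (l * c, u) = l • α (c, u) := by
  simp only [α, Prod.smul_mk, smul_smul, smul_eq_mul]
  congr 1
  · congr 1; ring
  · ring

namespace CoreData

variable (D : CoreData)

/-! ### The leaf chart `L (c, Y) = (Y, f c Y)` and its smooth inverse -/

/-- `L` is injective on `U` (the leaves are disjoint graphs). -/
theorem injOn_L : InjOn D.L U := by
  rintro ⟨c₁, Y₁⟩ h₁ ⟨c₂, Y₂⟩ h₂ h
  simp only [L, Prod.mk.injEq] at h
  obtain ⟨rfl, h⟩ := h
  exact Prod.ext (D.f_injective_left h₁ h₂ h) rfl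

/-- `L⁻¹ ∘ L = id` on `U`. -/
theorem Linv_L {x : ℝ × E2} (hx : x ∈ U) : D.Linv (D.L x) = x :=
  D.injOn_L.leftInvOn_invFunOn hx

/-- `L` is smooth on `U`. -/
theorem contDiffAt_L {x : ℝ × E2} (hx : x ∈ U) : ContDiffAt ℝ ∞ D.L x := by
  obtain ⟨c, Y⟩ := x
  exact contDiffAt_snd.prodMk (D.contDiffAt_f hx Y)

/-- The partial derivative of `f` in `c` is at least `1`. -/
theorem one_le_fderiv_f {c : ℝ} (hc : 0 < c) (Y : E2) :
    1 ≤ fderiv ℝ (uncurry D.f) (c, Y) (1, 0) := by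
  set φ := fderiv ℝ (uncurry D.f) (c, Y) with hφdef
  have hφ : HasFDerivAt (uncurry D.f) φ (c, Y) :=
    ((D.contDiffAt_f hc Y).differentiableAt (by simp)).hasFDerivAt
  have h1 : HasDerivAt (fun m : ℝ => D.f m Y) (φ (1, 0)) c := by
    have h := (hφ.comp c (hasFDerivAt_prodMk_left c Y)).hasDerivAt
    have h' : HasDerivAt (fun m : ℝ => D.f m Y)
        ((φ.comp (ContinuousLinearMap.inl ℝ ℝ E2)) (1 : ℝ)) c := h
    simpa using h'
  set g : ℝ → ℝ := fun m => D.f (max m (c / 2)) Y - max m (c / 2) with hg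
  have hmono : Monotone g := by
    intro a b hab
    have hmax : max a (c / 2) ≤ max b (c / 2) := max_le_max hab le_rfl
    have hpos : 0 < max a (c / 2) := lt_of_lt_of_le (by linarith) (le_max_right _ _)
    have := D.sub_le_f_sub_f hpos hmax Y
    simp only [hg]; linarith
  have h2 : HasDerivAt g (φ (1, 0) - 1) c := by
    have h3 : HasDerivAt (fun m => D.f m Y - m) (φ (1, 0) - 1) c := h1.sub (hasDerivAt_id c)
    refine h3.congr_of_eventuallyEq ?_
    filter_upwards [Ioi_mem_nhds (by linarith : c / 2 < c)] with m hm
    have hm' : c / 2 < m := hm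
    simp [hg, max_eq_left hm'.le]
  have := h2.nonneg_of_monotone hmono
  linarith

/-- The inverse `Linv` is smooth at every point of `L(U)` (inverse function theorem). -/
theorem contDiffAt_Linv {x : ℝ × E2} (hx : x ∈ U) : ContDiffAt ℝ ∞ D.Linv (D.L x) := by
  obtain ⟨c, Y⟩ := x
  have hc : 0 < c := hx
  set φ := fderiv ℝ (uncurry D.f) (c, Y) with hφdef
  have hφ : HasFDerivAt (uncurry D.f) φ (c, Y) :=
    ((D.contDiffAt_f hc Y).differentiableAt (by simp)).hasFDerivAt
  set a := φ (1, 0) with ha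
  have ha1 : 1 ≤ a := D.one_le_fderiv_f hc Y
  have ha0 : a ≠ 0 := by positivity
  have key : ∀ (m : ℝ) (v : E2), φ (m, v) = m * a + φ (0, v) := by
    intro m v
    have : ((m, v) : ℝ × E2) = m • ((1 : ℝ), (0 : E2)) + ((0 : ℝ), v) := by ext <;> simp
    rw [this, map_add, map_smul, smul_eq_mul]
  let L' : (ℝ × E2) →L[ℝ] (E2 × ℝ) := (ContinuousLinearMap.snd ℝ ℝ E2).prod φ
  let ψ : (E2 × ℝ) →L[ℝ] (ℝ × E2) :=
    (a⁻¹ • (ContinuousLinearMap.snd ℝ E2 ℝ -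
      φ.comp ((ContinuousLinearMap.inr ℝ ℝ E2).comp (ContinuousLinearMap.fst ℝ E2 ℝ)))).prod
      (ContinuousLinearMap.fst ℝ E2 ℝ)
  have h₁ : Function.LeftInverse ψ L' := by
    rintro ⟨m, v⟩
    simp only [L', ψ, ContinuousLinearMap.prod_apply, ContinuousLinearMap.coe_snd',
      FunLike.coe_smul, FunLike.coe_sub, Pi.smul_apply, Pi.sub_apply,
      ContinuousLinearMap.coe_comp, Function.comp_apply, ContinuousLinearMap.coe_fst',
      ContinuousLinearMap.inr_apply, smul_eq_mul, Prod.mk.injEq, and_true]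
    rw [key m v]
    field_simp
    ring
  have h₂ : Function.RightInverse ψ L' := by
    rintro ⟨v, s⟩
    simp only [L', ψ, ContinuousLinearMap.prod_apply, ContinuousLinearMap.coe_snd',
      FunLike.coe_smul, FunLike.coe_sub, Pi.smul_apply, Pi.sub_apply,
      ContinuousLinearMap.coe_comp, Function.comp_apply, ContinuousLinearMap.coe_fst',
      ContinuousLinearMap.inr_apply, smul_eq_mul, Prod.mk.injEq, true_and]
    rw [key]
    field_simp
    ring
  let Leq : (ℝ × E2) ≃L[ℝ] (E2 × ℝ) := ContinuousLinearEquiv.equivOfInverse L' ψ h₁ h₂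
  have hL : ContDiffAt ℝ ∞ D.L (c, Y) := D.contDiffAt_L hx
  have hderiv : HasFDerivAt D.L (Leq : (ℝ × E2) →L[ℝ] (E2 × ℝ)) (c, Y) :=
    hasFDerivAt_snd.prodMk hφ
  have hn : (∞ : WithTop ℕ∞) ≠ 0 := by simp
  have hinv := hL.to_localInverse hderiv hn
  have hagree : ∀ᶠ y in 𝓝 (D.L (c, Y)), D.Linv y = hL.localInverse hderiv hn y := by
    apply (hL.hasStrictFDerivAt' hderiv hn).localInverse_unique
    have hU : IsOpen (U : Set (ℝ × E2)) := isOpen_lt continuous_const continuous_fst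
    filter_upwards [hU.mem_nhds hx] with x' hx'
    exact D.Linv_L hx'
  exact hinv.congr_of_eventuallyEq hagree

end CoreData

end HomothetyCover

end Summit.SmoothPoincare4.SmoothPoincare4.Theorems

end
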